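import Mathlib
import HarnessLib
import Summits.MatrixMultiplication.MatrixMultiplication.Theses.LevelGradedCohnUmans
import Literature.Barriers.MatrixMultiplication.NormalizerBarrier

/-!
# `SubgroupIdentityLink` — the subgroup engine is load-bearing

Route `MatrixMultiplication/LevelGradedCohnUmans`, item `stmt-MatrixMultiplication-14081` (support):
`SubgroupIdentityDesigns → LieRankDesigns`.

Given `ε > 0` and the subgroup witness `(p, m, k, H₁, H₂, H₃)` — the subgroup triple product
property `SubgroupTPP H₁ H₂ H₃` (tree, `Literature.Barriers.MatrixMultiplication.NormalizerBarrier`),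
ONE Fourier-rank-`≤ k` test `f(g) = Σ_{rk M ≤ k} c_M ψ(tr(M g))` (`ψ = ZMod.stdAddChar`) with
`f(1) = 1` and `f(abc) = 0` for `a ∈ H₁, b ∈ H₂, c ∈ H₃`, `abc ≠ 1`, and the graded budget
inequality — take `X, Y, Z` to be the carriers of `H₁, H₂, H₃` as `Finset`s
(`Finset.univ.filter (· ∈ Hᵢ)`, of cardinality `Nat.card Hᵢ`).  For the target `(x₀, z₀)` use the
translate `g ↦ f(x₀ g z₀⁻¹)`, again of Fourier rank `≤ k` (`tr(M x₀ g z₀⁻¹) = tr((z₀⁻¹ M x₀) g)` and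
`rk(z₀⁻¹ M x₀) = rk M`: `rankTest_translate`), which on a quadruple `(x, y, y', z)` reads `f(abc)`
with `a = x₀x⁻¹ ∈ H₁`, `b = yy'⁻¹ ∈ H₂`, `c = zz₀⁻¹ ∈ H₃`, hence equals `[abc = 1] =
[x = x₀ ∧ y = y' ∧ z = z₀]` by the subgroup TPP.  The budget is verbatim.

Ported from the crux chain's kernel-checked `isRankTest_translate` / `subgroup_rankSeparated_iff`
(`Cruxes/LieRankDesigns/IdeatorSketch2.lean`), restated over the route's inlined binders.
-/

-- single-conjunct summit: the mandated namespace `Summit.MatrixMultiplication.MatrixMultiplication.…`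
-- repeats `MatrixMultiplication` (summit = sub-problem), which `linter.dupNamespace` would flag.
set_option linter.dupNamespace false

noncomputable section

open scoped BigOperators

namespace Summit.MatrixMultiplication.MatrixMultiplication.Theorems

/-- **Bi-invariance of the Fourier-rank-`≤ k` test space** of `GL_m(𝔽_p)`: if
`f(g) = Σ_M c_M ψ(tr(M g))` with `c_M = 0` whenever `rk M > k`, then for all `a, b ∈ GL_m(𝔽_p)` the
translate `g ↦ f(a g b)` is again of this form, with coefficients `c'_{M'} = c_{b⁻¹ M' a⁻¹}`
(reindex `M ↦ b M a`; `tr(M a g b) = tr((b M a) g)` and `rk(b M a) = rk M`). [folklore] -/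
theorem rankTest_translate {p m k : ℕ} [Fact p.Prime] (c : Matrix (Fin m) (Fin m) (ZMod p) → ℂ)
    (hc : ∀ M, k < M.rank → c M = 0) (a b : Matrix.GeneralLinearGroup (Fin m) (ZMod p)) :
    ∃ c' : Matrix (Fin m) (Fin m) (ZMod p) → ℂ, (∀ M, k < M.rank → c' M = 0) ∧
      ∀ g : Matrix.GeneralLinearGroup (Fin m) (ZMod p),
        (∑ M : Matrix (Fin m) (Fin m) (ZMod p), c' M * ZMod.stdAddChar (Matrix.trace
          (M * (g : Matrix (Fin m) (Fin m) (ZMod p))))) =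
        ∑ M : Matrix (Fin m) (Fin m) (ZMod p), c M * ZMod.stdAddChar (Matrix.trace
          (M * ((a * g * b : Matrix.GeneralLinearGroup (Fin m) (ZMod p)) :
            Matrix (Fin m) (Fin m) (ZMod p)))) := by
  refine ⟨fun M' => c (((b⁻¹ : Matrix.GeneralLinearGroup (Fin m) (ZMod p)) :
      Matrix (Fin m) (Fin m) (ZMod p)) * M' *
      ((a⁻¹ : Matrix.GeneralLinearGroup (Fin m) (ZMod p)) : Matrix (Fin m) (Fin m) (ZMod p))),
    fun M' hM' => hc _ ?_, fun g => ?_⟩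
  · -- the rank is invariant under two-sided multiplication by invertible matrices
    rwa [Matrix.rank_mul_eq_left_of_isUnit_det _ _ (Matrix.isUnits_det_units a⁻¹),
      Matrix.rank_mul_eq_right_of_isUnit_det _ _ (Matrix.isUnits_det_units b⁻¹)]
  · symm
    refine Fintype.sum_equiv ((Units.mulLeft b).trans (Units.mulRight a)) _ _ (fun M => ?_)
    have hM : ((b⁻¹ : Matrix.GeneralLinearGroup (Fin m) (ZMod p)) : Matrix (Fin m) (Fin m) (ZMod p)) *
        ((b : Matrix (Fin m) (Fin m) (ZMod p)) * M * (a : Matrix (Fin m) (Fin m) (ZMod p))) *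
        ((a⁻¹ : Matrix.GeneralLinearGroup (Fin m) (ZMod p)) : Matrix (Fin m) (Fin m) (ZMod p)) = M := by
      simp only [Matrix.mul_assoc, Units.mul_inv, Matrix.mul_one, Units.inv_mul_cancel_left]
    simp only [Equiv.trans_apply, Units.mulLeft_apply, Units.mulRight_apply, hM]
    congr 2
    rw [Units.val_mul, Units.val_mul,
      show M * ((a : Matrix (Fin m) (Fin m) (ZMod p)) * (g : Matrix (Fin m) (Fin m) (ZMod p)) *
          (b : Matrix (Fin m) (Fin m) (ZMod p))) =
        (M * (a : Matrix (Fin m) (Fin m) (ZMod p)) * (g : Matrix (Fin m) (Fin m) (ZMod p))) *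
          (b : Matrix (Fin m) (Fin m) (ZMod p)) by simp only [Matrix.mul_assoc],
      Matrix.trace_mul_comm, ← Matrix.mul_assoc, ← Matrix.mul_assoc]

open Summit.MatrixMultiplication.MatrixMultiplication.Theses.LevelGradedCohnUmans in
/-- **The subgroup engine is load-bearing** (settles `stmt-MatrixMultiplication-14081`, exact route
signature `Summit.MatrixMultiplication.MatrixMultiplication.Theses.LevelGradedCohnUmans.SubgroupIdentityLink`):
`SubgroupIdentityDesigns → LieRankDesigns`.  Given `ε > 0` and the subgroup witness
`(p, m, k, H₁, H₂, H₃, TPP, identity test, budget)`, take `X, Y, Z := Finset.univ.filter (· ∈ Hᵢ)`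
(cardinalities `Nat.card Hᵢ`, so the budget clause is verbatim); the target `(x₀, z₀)` is separated
by the `(x₀, z₀⁻¹)`-translate of the identity test (`rankTest_translate`), whose value on the
quadruple `(x, y, y', z)` is the identity test at `(x₀x⁻¹)(yy'⁻¹)(zz₀⁻¹) ∈ H₁H₂H₃`, i.e.
`[x = x₀ ∧ y = y' ∧ z = z₀]` by `SubgroupTPP`. [folklore] -/
theorem subgroupIdentityLink_proof :
    Summit.MatrixMultiplication.MatrixMultiplication.Theses.LevelGradedCohnUmans.SubgroupIdentityLink := by
  unfold SubgroupIdentityLink SubgroupIdentityDesigns LieRankDesigns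
  intro hdesigns ε hε
  obtain ⟨p, hp, m, k, H₁, H₂, H₃, htpp, ⟨c, hc, hone, hzero⟩, hbudget⟩ := hdesigns ε hε
  classical
  have hcard : ∀ H : Subgroup (Matrix.GeneralLinearGroup (Fin m) (ZMod p)),
      (Finset.univ.filter (· ∈ H)).card = Nat.card H := fun H =>
    (Nat.subtype_card (p := (· ∈ H)) (Finset.univ.filter (· ∈ H)) (fun x => by simp)).symm
  refine ⟨p, hp, m, k, Finset.univ.filter (· ∈ H₁), Finset.univ.filter (· ∈ H₂),
    Finset.univ.filter (· ∈ H₃), ?_, ?_⟩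
  · -- separation: translate the identity test to the target `(x₀, z₀)`
    intro x₀ hx₀ z₀ hz₀
    simp only [Finset.mem_filter, Finset.mem_univ, true_and] at hx₀ hz₀
    obtain ⟨c', hc', hsum⟩ := rankTest_translate c hc x₀ z₀⁻¹
    refine ⟨c', hc', ?_⟩
    intro x hx y hy y' hy' z hz
    simp only [Finset.mem_filter, Finset.mem_univ, true_and] at hx hy hy' hz
    rw [hsum]
    have hregroup : x₀ * (x⁻¹ * y * y'⁻¹ * z) * z₀⁻¹ = (x₀ * x⁻¹) * (y * y'⁻¹) * (z * z₀⁻¹) := by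
      group
    rw [hregroup]
    have ha : x₀ * x⁻¹ ∈ H₁ := H₁.mul_mem hx₀ (H₁.inv_mem hx)
    have hb : y * y'⁻¹ ∈ H₂ := H₂.mul_mem hy (H₂.inv_mem hy')
    have hg : z * z₀⁻¹ ∈ H₃ := H₃.mul_mem hz (H₃.inv_mem hz₀)
    by_cases h1 : (x₀ * x⁻¹) * (y * y'⁻¹) * (z * z₀⁻¹) = 1
    · obtain ⟨e1, e2, e3⟩ := htpp _ ha _ hb _ hg h1
      rw [h1, hone, if_pos ⟨(mul_inv_eq_one.mp e1).symm, mul_inv_eq_one.mp e2,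
        mul_inv_eq_one.mp e3⟩]
    · rw [hzero _ ha _ hb _ hg h1, if_neg]
      rintro ⟨rfl, rfl, rfl⟩
      exact h1 (by simp only [mul_inv_cancel, one_mul])
  · -- budget: the carriers have cardinality `Nat.card Hᵢ`
    rw [hcard, hcard, hcard]
    exact hbudget

end Summit.MatrixMultiplication.MatrixMultiplication.Theorems
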